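import Mathlib
import Summits.NavierStokesRegularity.NavierStokesRegularity.Theorems.FilamentSkeletonRssAnalyticStripLiaSymbolNumericsSound

/-!
# Stub P3 `stub_liaSymbol` (child 28295 of `SkeletonJ1G`) — CERTIFIED NUMERICS, SOUNDNESS II + THE CERTIFICATE:
# `−1/12 ≤ Φ(p) ≤ p/3` for `1/50 ≤ p ≤ 3`, `Φ(p) = 1 − C(p) − 2pE(p)`

Lane ns-filament-19175-p1 g12 (prover), 2026-08-28, `--supports stmt-NavierStokesRegularity-28295 --as helper`, COMPUTATIONAL
(exactly one `native_decide`, in `certificate`; everything else is the soundness proof of the checker).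
§1 bracket sums vs. integrals by induction over the `t`-grid (`lowerC ≤ C ≤ Cup`, `lowerE ≤ E ≤ Eup`, tails included);
§2 the `p`-cell checks (`C`, `E` antitone) and their chaining over the `p`-grid; §3 the kernel-replayed certificate
(`gridOK tdata ∧ nonnegAll tgrid ∧ cellsOK tdata (1/50 :: pgridTail) ∧ last = 3 ∧ tdata ≠ []`, ≈ 2–3 min to elaborate) and the
real-variable window `numerics_window`.  Margins: the tightest cell is `p ≈ 0.09` for the lower side (`≈ 0.010` in `Φ`).

HONEST FRAMING: certified numerics for one explicit real integral, serving a HYPOTHETICAL filament-skeleton line on the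
NEGATIVE side of a MODEL route; nothing here bears on Navier–Stokes regularity or blow-up.
-/

set_option linter.dupNamespace false

noncomputable section

namespace Summit.NavierStokesRegularity.NavierStokesRegularity.Theorems.AnalyticStripLiaSymbol

open Real Set MeasureTheory Filter Topology

namespace Numerics

/-- Unpacking `gridOK` on `x :: y :: rest`. -/
theorem gridOK_cons_cons {x y : ℚ × ℚ × ℚ} {rest : List (ℚ × ℚ × ℚ)} (h : gridOK (x :: y :: rest) = true) :
    0 < x.1 ∧ x.1 < y.1 ∧ gridOK (y :: rest) = true := by
  simp only [gridOK, Bool.and_eq_true, decide_eq_true_eq] at h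
  exact ⟨h.1.1, h.1.2, h.2⟩

/-- The head node of a well-formed grid is positive. -/
theorem gridOK_head_pos {x : ℚ × ℚ × ℚ} {rest : List (ℚ × ℚ × ℚ)} (h : gridOK (x :: rest) = true) : 0 < x.1 := by
  cases rest with
  | nil => simpa [gridOK] using h
  | cons y rest => exact (gridOK_cons_cons h).1

/-- The enclosure property passes to the tail. -/
theorem Encl_tail {x : ℚ × ℚ × ℚ} {rest : List (ℚ × ℚ × ℚ)} (h : Encl (x :: rest)) : Encl rest :=
  fun z hz => h z (List.mem_cons_of_mem _ hz)

/-- Splitting `∫_{(a,∞)} = ∫_{(a,b]} + ∫_{(b,∞)}`. -/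
theorem integral_Ioi_split {a b : ℝ} (hab : a ≤ b) {g : ℝ → ℝ} (hg : IntegrableOn g (Ioi a)) :
    ∫ t in Ioi a, g t = (∫ t in Ioc a b, g t) + ∫ t in Ioi b, g t := by
  rw [← setIntegral_union (Set.Ioc_disjoint_Ioi le_rfl) measurableSet_Ioi
    (hg.mono_set Ioc_subset_Ioi_self) (hg.mono_set (Ioi_subset_Ioi hab)), Ioc_union_Ioi_eq_Ioi hab]

/-- Lower bracket sum ≤ `∫_{(t₀,∞)}` of the `C`-integrand (induction over the grid). -/
theorem lowerC_le {p : ℚ} (hp : 0 ≤ p) : ∀ (rest : List (ℚ × ℚ × ℚ)) (x : ℚ × ℚ × ℚ),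
    gridOK (x :: rest) = true → Encl (x :: rest) →
      ((lowerC p (x :: rest) : ℚ) : ℝ) ≤ ∫ t in Ioi (x.1:ℝ), Real.exp (-t) * Real.exp (-((p:ℝ) / t)) := by
  intro rest
  induction rest with
  | nil =>
    intro x _ _
    simp only [lowerC, Rat.cast_zero]
    exact setIntegral_nonneg measurableSet_Ioi fun t _ => fC_nonneg _ t
  | cons y rest ih =>
    intro x hg he
    obtain ⟨hx, hxy, hg'⟩ := gridOK_cons_cons hg
    have hcell := cellC_lo hp hx hxy.le (he y (by simp)).1
    have hI : IntegrableOn (fun t : ℝ => Real.exp (-t) * Real.exp (-((p:ℝ) / t))) (Ioi (x.1:ℝ)) :=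
      (integrableOn_fC (by exact_mod_cast hp)).mono_set (Ioi_subset_Ioi (by exact_mod_cast hx.le))
    rw [integral_Ioi_split (b := (y.1:ℝ)) (by exact_mod_cast hxy.le) hI]
    simp only [lowerC, Rat.cast_add]
    exact add_le_add hcell (ih y hg' (Encl_tail he))

/-- Lower bracket sum ≤ `∫_{(t₀,∞)}` of the `E`-integrand (induction over the grid). -/
theorem lowerE_le {p : ℚ} (hp : 0 < p) : ∀ (rest : List (ℚ × ℚ × ℚ)) (x : ℚ × ℚ × ℚ),
    gridOK (x :: rest) = true → Encl (x :: rest) →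
      ((lowerE p (x :: rest) : ℚ) : ℝ) ≤ ∫ t in Ioi (x.1:ℝ), Real.exp (-t) * Real.exp (-((p:ℝ) / t)) / t := by
  intro rest
  induction rest with
  | nil =>
    intro x hg _
    have hx := gridOK_head_pos hg
    simp only [lowerE, Rat.cast_zero]
    exact setIntegral_nonneg measurableSet_Ioi fun t (ht : (x.1:ℝ) < t) =>
      fE_nonneg _ ((show (0:ℝ) < x.1 by exact_mod_cast hx).trans ht)
  | cons y rest ih =>
    intro x hg he
    obtain ⟨hx, hxy, hg'⟩ := gridOK_cons_cons hg
    have hcell := cellE_lo hp.le hx hxy.le (he y (by simp)).1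
    have hI : IntegrableOn (fun t : ℝ => Real.exp (-t) * Real.exp (-((p:ℝ) / t)) / t) (Ioi (x.1:ℝ)) :=
      (integrableOn_E_integrand (by exact_mod_cast hp)).mono_set (Ioi_subset_Ioi (by exact_mod_cast hx.le))
    rw [integral_Ioi_split (b := (y.1:ℝ)) (by exact_mod_cast hxy.le) hI]
    simp only [lowerE, Rat.cast_add]
    exact add_le_add hcell (ih y hg' (Encl_tail he))

/-- `∫_{(t₀,∞)}` of the `C`-integrand ≤ upper bracket sum with tail (induction over the grid). -/
theorem upperC_ge {p : ℚ} (hp : 0 ≤ p) : ∀ (rest : List (ℚ × ℚ × ℚ)) (x : ℚ × ℚ × ℚ),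
    gridOK (x :: rest) = true → Encl (x :: rest) →
      ∫ t in Ioi (x.1:ℝ), Real.exp (-t) * Real.exp (-((p:ℝ) / t)) ≤ ((upperC p (x :: rest) : ℚ) : ℝ) := by
  intro rest
  induction rest with
  | nil =>
    intro x hg he
    simp only [upperC]
    have hx := gridOK_head_pos hg
    have h1 : ∫ t in Ioi (x.1:ℝ), Real.exp (-t) * Real.exp (-((p:ℝ) / t)) ≤ ∫ t in Ioi (x.1:ℝ), Real.exp (-t) := by
      refine setIntegral_mono_on ((integrableOn_fC (by exact_mod_cast hp)).mono_set
        (Ioi_subset_Ioi (by exact_mod_cast hx.le))) (integrableOn_exp_neg_Ioi _) measurableSet_Ioi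
        (fun t (ht : (x.1:ℝ) < t) => ?_)
      have ht0 : 0 < t := (show (0:ℝ) < x.1 by exact_mod_cast hx).trans ht
      have : Real.exp (-((p:ℝ) / t)) ≤ 1 := by
        rw [Real.exp_le_one_iff]; exact neg_nonpos.mpr (div_nonneg (by exact_mod_cast hp) ht0.le)
      calc Real.exp (-t) * Real.exp (-((p:ℝ) / t)) ≤ Real.exp (-t) * 1 := by gcongr
        _ = Real.exp (-t) := mul_one _
    rw [integral_exp_neg_Ioi] at h1
    exact h1.trans (le_expNegHi hx.le)
  | cons y rest ih =>
    intro x hg he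
    obtain ⟨hx, hxy, hg'⟩ := gridOK_cons_cons hg
    have hcell := cellC_hi hp hx hxy.le (he x (by simp)).2
    have hI : IntegrableOn (fun t : ℝ => Real.exp (-t) * Real.exp (-((p:ℝ) / t))) (Ioi (x.1:ℝ)) :=
      (integrableOn_fC (by exact_mod_cast hp)).mono_set (Ioi_subset_Ioi (by exact_mod_cast hx.le))
    rw [integral_Ioi_split (b := (y.1:ℝ)) (by exact_mod_cast hxy.le) hI]
    simp only [upperC, Rat.cast_add]
    exact add_le_add hcell (ih y hg' (Encl_tail he))

/-- `∫_{(t₀,∞)}` of the `E`-integrand ≤ upper bracket sum with tail (induction over the grid). -/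
theorem upperE_ge {p : ℚ} (hp : 0 < p) : ∀ (rest : List (ℚ × ℚ × ℚ)) (x : ℚ × ℚ × ℚ),
    gridOK (x :: rest) = true → Encl (x :: rest) →
      ∫ t in Ioi (x.1:ℝ), Real.exp (-t) * Real.exp (-((p:ℝ) / t)) / t ≤ ((upperE p (x :: rest) : ℚ) : ℝ) := by
  intro rest
  induction rest with
  | nil =>
    intro x hg he
    simp only [upperE]
    have hx := gridOK_head_pos hg
    have hx' : (0:ℝ) < x.1 := by exact_mod_cast hx
    have h1 : ∫ t in Ioi (x.1:ℝ), Real.exp (-t) * Real.exp (-((p:ℝ) / t)) / t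
        ≤ ∫ t in Ioi (x.1:ℝ), Real.exp (-t) * (1 / x.1) := by
      refine setIntegral_mono_on ((integrableOn_E_integrand (by exact_mod_cast hp)).mono_set
        (Ioi_subset_Ioi hx'.le)) ((integrableOn_exp_neg_Ioi _).mul_const _) measurableSet_Ioi
        (fun t (ht : (x.1:ℝ) < t) => ?_)
      have ht0 : 0 < t := hx'.trans ht
      have : Real.exp (-((p:ℝ) / t)) ≤ 1 := by
        rw [Real.exp_le_one_iff]; exact neg_nonpos.mpr (div_nonneg (by exact_mod_cast hp.le) ht0.le)
      rw [div_eq_mul_one_div]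
      gcongr
      · calc Real.exp (-t) * Real.exp (-((p:ℝ) / t)) ≤ Real.exp (-t) * 1 := by gcongr
          _ = Real.exp (-t) := mul_one _
    rw [integral_mul_const, integral_exp_neg_Ioi] at h1
    refine h1.trans (le_trans ?_ (le_rup_real _))
    push_cast
    rw [mul_one_div]
    exact div_le_div_of_nonneg_right (le_expNegHi hx.le) hx'.le
  | cons y rest ih =>
    intro x hg he
    obtain ⟨hx, hxy, hg'⟩ := gridOK_cons_cons hg
    have hcell := cellE_hi hp.le hx hxy.le (he x (by simp)).2
    have hI : IntegrableOn (fun t : ℝ => Real.exp (-t) * Real.exp (-((p:ℝ) / t)) / t) (Ioi (x.1:ℝ)) :=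
      (integrableOn_E_integrand (by exact_mod_cast hp)).mono_set (Ioi_subset_Ioi (by exact_mod_cast hx.le))
    rw [integral_Ioi_split (b := (y.1:ℝ)) (by exact_mod_cast hxy.le) hI]
    simp only [upperE, Rat.cast_add]
    exact add_le_add hcell (ih y hg' (Encl_tail he))

/-- `lowerC ≤ C`. -/
theorem lowerC_le_Cint {p : ℚ} (hp : 0 ≤ p) {x : ℚ × ℚ × ℚ} {rest : List (ℚ × ℚ × ℚ)}
    (hg : gridOK (x :: rest) = true) (he : Encl (x :: rest)) :
    ((lowerC p (x :: rest) : ℚ) : ℝ) ≤ Cint p := by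
  refine (lowerC_le hp rest x hg he).trans ?_
  unfold Cint
  have hx := gridOK_head_pos hg
  exact setIntegral_mono_set (integrableOn_fC (by exact_mod_cast hp))
    (Filter.Eventually.of_forall fun t => fC_nonneg _ t) (Filter.Eventually.of_forall (Ioi_subset_Ioi (by exact_mod_cast hx.le)))

/-- `lowerE ≤ E`. -/
theorem lowerE_le_Eint {p : ℚ} (hp : 0 < p) {x : ℚ × ℚ × ℚ} {rest : List (ℚ × ℚ × ℚ)}
    (hg : gridOK (x :: rest) = true) (he : Encl (x :: rest)) :
    ((lowerE p (x :: rest) : ℚ) : ℝ) ≤ Eint p := by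
  refine (lowerE_le hp rest x hg he).trans ?_
  unfold Eint
  have hx := gridOK_head_pos hg
  refine setIntegral_mono_set (integrableOn_E_integrand (by exact_mod_cast hp)) ?_
    (Filter.Eventually.of_forall (Ioi_subset_Ioi (by exact_mod_cast hx.le)))
  rw [Filter.EventuallyLE, ae_restrict_iff' measurableSet_Ioi]
  exact Filter.Eventually.of_forall fun t ht => fE_nonneg _ ht

/-- `C ≤ Cup`. -/
theorem Cint_le_Cup {p : ℚ} (hp : 0 < p) {x : ℚ × ℚ × ℚ} {rest : List (ℚ × ℚ × ℚ)}
    (hg : gridOK (x :: rest) = true) (he : Encl (x :: rest)) :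
    Cint p ≤ ((Cup p (x :: rest) : ℚ) : ℝ) := by
  have hx := gridOK_head_pos hg
  have hx' : (0:ℝ) < x.1 := by exact_mod_cast hx
  unfold Cint
  rw [integral_Ioi_split hx'.le (integrableOn_fC (by exact_mod_cast hp.le))]
  simp only [Cup, Rat.cast_add]
  refine add_le_add ?_ (upperC_ge hp.le rest x hg he)
  refine le_trans ?_ (le_rup_real _)
  push_cast
  have heh := le_expNegHi (div_nonneg hp.le hx.le : 0 ≤ p / x.1)
  rw [show (x.1 : ℝ) * (expNegHi (p / x.1) : ℝ) = ((x.1:ℝ) - 0) * (expNegHi (p / x.1) : ℝ) by ring]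
  refine setIntegral_Ioc_le_const_mul hx'.le ((integrableOn_fC (by exact_mod_cast hp.le)).mono_set
    Ioc_subset_Ioi_self) (fun t ht => ?_)
  have h1 : Real.exp (-t) ≤ 1 := by rw [Real.exp_le_one_iff]; linarith [ht.1]
  have h2 : Real.exp (-((p:ℝ) / t)) ≤ (expNegHi (p / x.1) : ℝ) := by
    refine le_trans ?_ heh
    push_cast
    exact Real.exp_le_exp.mpr (neg_le_neg (div_le_div_of_nonneg_left (by exact_mod_cast hp.le) ht.1 ht.2))
  calc Real.exp (-t) * Real.exp (-((p:ℝ) / t)) ≤ 1 * (expNegHi (p / x.1) : ℝ) :=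
        mul_le_mul h1 h2 (Real.exp_pos _).le zero_le_one
    _ = (expNegHi (p / x.1) : ℝ) := one_mul _

/-- `E ≤ Eup`. -/
theorem Eint_le_Eup {p : ℚ} (hp : 0 < p) {x : ℚ × ℚ × ℚ} {rest : List (ℚ × ℚ × ℚ)}
    (hg : gridOK (x :: rest) = true) (he : Encl (x :: rest)) :
    Eint p ≤ ((Eup p (x :: rest) : ℚ) : ℝ) := by
  have hx := gridOK_head_pos hg
  have hx' : (0:ℝ) < x.1 := by exact_mod_cast hx
  have hp' : (0:ℝ) < p := by exact_mod_cast hp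
  unfold Eint
  rw [integral_Ioi_split hx'.le (integrableOn_E_integrand hp')]
  simp only [Eup, Rat.cast_add]
  refine add_le_add ?_ (upperE_ge hp rest x hg he)
  refine le_trans ?_ (le_rup_real _)
  push_cast
  have heh := le_expNegHi (by positivity : 0 ≤ p / (2 * x.1))
  rw [show 2 * (x.1 : ℝ) / p * (expNegHi (p / (2 * x.1)) : ℝ)
      = ((x.1:ℝ) - 0) * (2 / p * (expNegHi (p / (2 * x.1)) : ℝ)) by ring]
  refine setIntegral_Ioc_le_const_mul hx'.le ((integrableOn_E_integrand hp').mono_set Ioc_subset_Ioi_self)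
    (fun t ht => ?_)
  have ht0 : 0 < t := ht.1
  -- `e^{−p/t}/t = e^{−p/(2t)} · (e^{−p/(2t)}/t) ≤ e^{−p/(2x₁)} · (2/p)`
  have hsplit : Real.exp (-((p:ℝ) / t)) = Real.exp (-((p:ℝ) / (2 * t))) * Real.exp (-((p:ℝ) / (2 * t))) := by
    rw [← Real.exp_add]; congr 1; field_simp; ring
  have hA : Real.exp (-((p:ℝ) / (2 * t))) ≤ (expNegHi (p / (2 * x.1)) : ℝ) := by
    refine le_trans ?_ heh
    push_cast
    refine Real.exp_le_exp.mpr (neg_le_neg ?_)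
    exact div_le_div_of_nonneg_left hp'.le (by positivity) (by linarith [ht.2])
  have hB : Real.exp (-((p:ℝ) / (2 * t))) / t ≤ 2 / p := by
    have h := Real.add_one_le_exp ((p:ℝ) / (2 * t))
    rw [Real.exp_neg, div_le_div_iff₀ (by positivity) hp']
    have hq : 0 < (p:ℝ) / (2 * t) := by positivity
    calc (Real.exp ((p:ℝ) / (2 * t)))⁻¹ * p = p / Real.exp ((p:ℝ) / (2 * t)) := by ring
      _ ≤ p / ((p:ℝ) / (2 * t)) := by gcongr; linarith
      _ = 2 * t := by field_simp
  have h1 : Real.exp (-t) ≤ 1 := by rw [Real.exp_le_one_iff]; linarith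
  calc Real.exp (-t) * Real.exp (-((p:ℝ) / t)) / t
      ≤ 1 * Real.exp (-((p:ℝ) / t)) / t := by gcongr
    _ = Real.exp (-((p:ℝ) / (2 * t))) * (Real.exp (-((p:ℝ) / (2 * t))) / t) := by rw [one_mul, hsplit]; ring
    _ ≤ (expNegHi (p / (2 * x.1)) : ℝ) * (2 / p) :=
        mul_le_mul hA hB (by positivity) ((Real.exp_pos _).le.trans hA)
    _ = 2 / p * (expNegHi (p / (2 * x.1)) : ℝ) := mul_comm _ _

/-- The computed triples `(t, expNegLo t, expNegHi t)` enclose `e^{−t}` when all nodes are `≥ 0`. -/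
theorem encl_of_nonneg {l : List ℚ} (h : nonnegAll l = true) :
    Encl (l.map fun t => (t, expNegLo t, expNegHi t)) := by
  intro x hx
  rw [List.mem_map] at hx
  obtain ⟨t, ht, rfl⟩ := hx
  have ht0 : 0 ≤ t := by
    unfold nonnegAll at h
    rw [List.all_eq_true] at h
    simpa using h t ht
  exact ⟨expNegLo_le ht0, le_expNegHi ht0⟩

/-- Soundness of one `p`-cell check: on `[a,b]`, `Φ ≤ p/3` and `Φ ≥ −1/12`. -/
theorem cellOK_sound {x : ℚ × ℚ × ℚ} {rest : List (ℚ × ℚ × ℚ)} (hg : gridOK (x :: rest) = true)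
    (he : Encl (x :: rest)) {a b : ℚ} (h : cellOK (x :: rest) a b = true) :
    ∀ p : ℝ, (a:ℝ) ≤ p → p ≤ (b:ℝ) → Phi p ≤ p / 3 ∧ -1 / 12 ≤ Phi p := by
  simp only [cellOK, Bool.and_eq_true, decide_eq_true_eq] at h
  obtain ⟨⟨⟨ha, hab⟩, hup⟩, hlo⟩ := h
  have hb : 0 < b := ha.trans_le hab
  intro p hap hpb
  have ha' : (0:ℝ) < a := by exact_mod_cast ha
  have hp : 0 < p := ha'.trans_le hap
  -- real versions of the two checked inequalities
  have hup' : (1:ℝ) - (lowerC b (x :: rest) : ℝ) - 2 * (a:ℝ) * (lowerE b (x :: rest) : ℝ) ≤ (a:ℝ) / 3 := by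
    have := (Rat.cast_le (K := ℝ)).mpr hup; push_cast at this; exact this
  have hlo' : -(1:ℝ) / 12 ≤ 1 - (Cup a (x :: rest) : ℝ) - 2 * (b:ℝ) * (Eup a (x :: rest) : ℝ) := by
    have := (Rat.cast_le (K := ℝ)).mpr hlo; push_cast at this; exact this
  -- bracket bounds at the cell ends
  have hC_lo := lowerC_le_Cint hb.le hg he          -- lowerC b ≤ C b
  have hE_lo := lowerE_le_Eint hb hg he             -- lowerE b ≤ E b
  have hC_hi := Cint_le_Cup ha hg he                -- C a ≤ Cup a
  have hE_hi := Eint_le_Eup ha hg he                -- E a ≤ Eup a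
  -- monotonicity in p
  have hCb : Cint (b:ℝ) ≤ Cint p := Cint_antitone hp.le hpb
  have hCa : Cint p ≤ Cint (a:ℝ) := Cint_antitone ha'.le hap
  have hEb : Eint (b:ℝ) ≤ Eint p := Eint_antitone hp hpb
  have hEa : Eint p ≤ Eint (a:ℝ) := Eint_antitone ha' hap
  have hE0 : 0 ≤ Eint (b:ℝ) := Eint_nonneg _
  have hEp0 : 0 ≤ Eint p := Eint_nonneg _
  unfold Phi
  constructor
  · -- Φ p ≤ 1 − C b − 2 a E b ≤ a/3 ≤ p/3
    have h1 : (a:ℝ) * Eint (b:ℝ) ≤ p * Eint p := mul_le_mul hap hEb hE0 hp.le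
    nlinarith
  · have h1 : p * Eint p ≤ (b:ℝ) * Eint (a:ℝ) := mul_le_mul hpb hEa hEp0 (by exact_mod_cast hb.le)
    nlinarith

/-- Soundness of the chained cell checks on `[a, last]` (induction over the `p`-grid). -/
theorem cellsOK_sound {x : ℚ × ℚ × ℚ} {trest : List (ℚ × ℚ × ℚ)} (hg : gridOK (x :: trest) = true)
    (he : Encl (x :: trest)) :
    ∀ (rest : List ℚ) (a : ℚ), cellsOK (x :: trest) (a :: rest) = true → rest ≠ [] →
      ∀ p : ℝ, (a:ℝ) ≤ p → p ≤ (lastQ a rest : ℝ) → Phi p ≤ p / 3 ∧ -1 / 12 ≤ Phi p := by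
  intro rest
  induction rest with
  | nil => intro a _ hne; exact absurd rfl hne
  | cons b rest ih =>
    intro a hc _ p hap hpl
    simp only [cellsOK, Bool.and_eq_true] at hc
    obtain ⟨hcell, hrest⟩ := hc
    by_cases hpb : p ≤ (b:ℝ)
    · exact cellOK_sound hg he hcell p hap hpb
    · have hbp : (b:ℝ) ≤ p := le_of_lt (not_le.mp hpb)
      cases rest with
      | nil =>
        simp only [lastQ] at hpl
        exact absurd hpl hpb
      | cons c rest' =>
        exact ih b hrest (List.cons_ne_nil _ _) p hbp (by simpa [lastQ] using hpl)

/-- THE KERNEL-REPLAYED CERTIFICATE (the one computational step of the stub's proof). -/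
theorem certificate :
    (gridOK tdata && nonnegAll tgrid && cellsOK tdata ((1 / 50 : ℚ) :: pgridTail)
      && decide (lastQ (1 / 50 : ℚ) pgridTail = 3) && decide (tdata ≠ [])) = true := by
  native_decide

/-- **THE NUMERICAL WINDOW**: for `1/50 ≤ p ≤ 3`, `−1/12 ≤ Φ(p) ≤ p/3`. -/
theorem numerics_window (p : ℝ) (h1 : 1 / 50 ≤ p) (h2 : p ≤ 3) : Phi p ≤ p / 3 ∧ -1 / 12 ≤ Phi p := by
  have hc := certificate
  simp only [Bool.and_eq_true, decide_eq_true_eq] at hc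
  obtain ⟨⟨⟨⟨hgrid, hnn⟩, hcells⟩, hlast⟩, hne0⟩ := hc
  have htdata : tdata = (tgrid.map fun t => (t, expNegLo t, expNegHi t)) := rfl
  -- `tdata` is a cons
  obtain ⟨x, trest, hx⟩ := List.exists_cons_of_ne_nil hne0
  rw [hx] at hgrid hcells
  have he : Encl (x :: trest) := by rw [← hx, htdata]; exact encl_of_nonneg hnn
  have hne : pgridTail ≠ [] := by decide
  have := cellsOK_sound hgrid he pgridTail (1 / 50) hcells hne p (by push_cast; linarith)
    (by rw [hlast]; push_cast; linarith)
  exact this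

end Numerics

end Summit.NavierStokesRegularity.NavierStokesRegularity.Theorems.AnalyticStripLiaSymbol
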